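import Summits.KontsevichZagierPeriods.Zeta5Search.Certificates.RecordRayClassWindowsD16A
import Summits.KontsevichZagierPeriods.Zeta5Search.Certificates.RecordRayClassWindowsD16B
import Summits.KontsevichZagierPeriods.Zeta5Search.Certificates.RecordRayClassWindowsD16C
import Summits.KontsevichZagierPeriods.Zeta5Search.Certificates.RecordRayClassWindowsF16N1
import Summits.KontsevichZagierPeriods.Zeta5Search.Certificates.RecordRayClassWindowsF16N2
import Summits.KontsevichZagierPeriods.Zeta5Search.Certificates.RecordRayClassWindowsF16N3
import Summits.KontsevichZagierPeriods.Zeta5Search.Certificates.RecordRayClassWindowsF16N4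
import Summits.KontsevichZagierPeriods.Zeta5Search.Certificates.RecordRayClassWindowsG16N1
import Summits.KontsevichZagierPeriods.Zeta5Search.Certificates.RecordRayClassWindowsG16N2
import Summits.KontsevichZagierPeriods.Zeta5Search.Certificates.RecordRayClassWindowsG16N3
import HarnessLib

/-!
# ζ(5) search — the record ray's DENOMINATORS, XI-e (G16): the CLASS-LAW WINDOW LIST (p3 g8)

HONEST FRAMING: systematic search; no irrationality claim unless certified.

OUR work (Summit side; prover seat p3, generation 8).  `cwinsG16` = the concatenation of the 10 part lists (547 class-law windows: the
F16 parts (p3 g6 / p3 g7) VERBATIM, then the new parts `cwinsG16N1`, `cwinsG16N2`, `cwinsG16N3`) with `cwinsG16_holds`.  Index `idx` of a kind-3/4/5 table row refers to this list.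
Valuations of rationals; every `γ < 1` — no irrationality content.
-/

noncomputable section

namespace Summit.KontsevichZagierPeriods.Zeta5Search.RecordRay

/-- All class-law windows of stage G16. -/
def cwinsG16 : List CWin := cwinsD16A ++ (cwinsD16B ++ (cwinsD16C ++ (cwinsF16N1 ++ (cwinsF16N2 ++ (cwinsF16N3 ++ (cwinsF16N4 ++ (cwinsG16N1 ++ (cwinsG16N2 ++ (cwinsG16N3)))))))))

/-- **Every class-law window holds.** -/
theorem cwinsG16_holds : ∀ c ∈ cwinsG16, c.Holds := by
  unfold cwinsG16
  exact List.forall_mem_append.2 ⟨cwinsD16A_holds, List.forall_mem_append.2 ⟨cwinsD16B_holds, List.forall_mem_append.2 ⟨cwinsD16C_holds, List.forall_mem_append.2 ⟨cwinsF16N1_holds, List.forall_mem_append.2 ⟨cwinsF16N2_holds, List.forall_mem_append.2 ⟨cwinsF16N3_holds, List.forall_mem_append.2 ⟨cwinsF16N4_holds, List.forall_mem_append.2 ⟨cwinsG16N1_holds, List.forall_mem_append.2 ⟨cwinsG16N2_holds, cwinsG16N3_holds⟩⟩⟩⟩⟩⟩⟩⟩⟩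

end Summit.KontsevichZagierPeriods.Zeta5Search.RecordRay
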